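import Summits.HodgeConjecture.HodgeConjecture.Theorems.R90S6HeckeCoeffIndepOfIso        -- ★ W7-a.4 `coeff_toVector_comp_eq_of_memLaw`
import Summits.HodgeConjecture.HodgeConjecture.Theorems.R90S6IndexSeparatesU2Inert       -- ★ W8-e′ `mem_orbit_of_ncard_orbit_eq_two_inert`

/-!
# R90 · S6 (Rogawski Ch. 14.1–5, stable trace formula) — W9-A.5: «eG-independence» AT AN INERT PLACE, `N = 2`
# (`Theorems/R90S6HeckeCoeffIndepInertTwo.lean`; `U_w = U(σ_w, antidiag(1,1))(E_w)`, `K₀ = unitaryInt`)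

Helper for the S6 floor sockets `R90.S6.StubR90ExtE1HeckeFL` (the `eH`-binder, `U(Φ₂)_w`-factor of `H_v`) ∕ `R90.S6.StubR90ExtE1TwistedTransferFL`
(`Cruxes/H413/Lines/R90_S6_FloorE1D.lean`), DAG r5 row E1.3.9.1; the `N = 2` twin of the W9-A sheet target (A.2) `coeff_toVector_comp_eq_of_memLaw_inert`
(`R90/R90-C14-typ1/g2/S6_wave9A_targets.v1.db09522d8f01f282.lean` :138, binders `3 ↦ 2`, NO `ϖ ∕ hd` binder).  PROOF: a uniformiser `ϖ` with the unramified datum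
exists at an inert place (★ `UnitaryGroup.unramifiedLocalConjDatum_adicCompletion c hc v w hw hv`); ★ W7-a.4 `coeff_toVector_comp_eq_of_memLaw` with `hsep :=` ★ W8-e′
`mem_orbit_of_ncard_orbit_eq_two_inert c v hc hv w hw hd`.

Cell `hodgecm-mathlib`, crux H413 (`stmt-HodgeConjecture-24833`), route of record `HCCMUnconditional`; programme R90-TF (brief `director/R90-BRIEF.v2.md`),
section S6 (base `R90-C14`), seat R90-C14-p02 (g2) (S6 dealer R90-C14-plan (g2) 2026-09-04T23:58:41Z «(A.5)∕(A.6) N = 2 twins»).  Lane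
`--supports stmt-HodgeConjecture-24833 --as helper`; ONE theorem, no definition, no `sorry`, no instance, no notation; imports ★ Theorems only (never Lines).
HONEST LABEL: a helper theorem, count-neutral until the E1.3.9 ∕ E1.4.4.5a assemblies consume it; HC_CM is proved only modulo the 7 printed citations
(2 remaining named inputs: hLiu418 = stmt-HodgeConjecture-24832, h413 = stmt-HodgeConjecture-24833) until rung 0 closes.

## References
* [CartierCorvallis1979] P. Cartier, *Representations of p-adic groups: a survey*, Proc. Sympos. Pure Math. 33 (1979), Part 1, §IV.1.
* [BruhatTits1972] F. Bruhat, J. Tits, *Groupes réductifs sur un corps local I*, Publ. Math. IHÉS 41 (1972), (4.4.3), (4.4.4).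
* [Tits1979] J. Tits, *Reductive groups over local fields*, Proc. Sympos. Pure Math. 33 (1979), Part 1, §3.3.3.
-/

set_option autoImplicit false
-- the mandated namespace repeats the single-problem summit's segment (`HodgeConjecture.HodgeConjecture`)
set_option linter.dupNamespace false

noncomputable section

open scoped Valued WithZero Matrix MatrixGroups

open MulAction MonoidAlgebra
open Literature.NumberTheory.Automorphic Literature.NumberTheory.Automorphic.HermitianLattice
  Literature.NumberTheory.Automorphic.UnitaryLatticeTree

namespace Summit.HodgeConjecture.HodgeConjecture.R90.S6

section InertPlace

open _root_.NumberField _root_.IsDedekindDomain Literature.NumberTheory.Automorphic.UnitaryGroup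

variable {k : Type*} [CommRing k]
variable {F E : Type} [Field F] [NumberField F] [Field E] [NumberField E] [Algebra F E] [Algebra.IsQuadraticExtension F E]
  (c : E ≃ₐ[F] E) (v : HeightOneSpectrum (𝓞 F))

/-- **W9-A.5 «eG-INDEPENDENCE» AT AN INERT UNRAMIFIED PLACE, `N = 2`** (`U_w = U(σ_w, J₀)(E_w)`, `J₀ = antidiag(1,1)`, `K₀ = unitaryInt`): for a quadratic
extension `E ∕ F` of number fields, `c ≠ 1` in `Gal(E∕F)`, `v` unramified in `E`, `w ∣ v` with `c • w = w`, any two group isomorphisms `e e' : Gv ≃* U_w` carrying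
`Kv` onto `K₀` read every `T ∈ ℋ(U_w, K₀)` as the SAME function `g ↦ (T [K₀])((e g) K₀)` on `Gv`.  Route: `⟨ϖ, hd⟩ :=` ★ `unramifiedLocalConjDatum_adicCompletion`;
★ W7-a.4 `coeff_toVector_comp_eq_of_memLaw` with `hsep :=` ★ W8-e′ `mem_orbit_of_ncard_orbit_eq_two_inert`.  The `N = 2` twin of W9-A (A.2).
[folklore; cite: CartierCorvallis1979, §IV.1] [cite: BruhatTits1972, (4.4.3), (4.4.4)] [cite: Tits1979, §3.3.3] -/
theorem coeff_toVector_comp_eq_of_memLaw_inert_two (hc : c ≠ 1) (hv : Algebra.IsUnramifiedIn (𝓞 E) v.asIdeal) (w : UnitaryGroup.PlacesOver E v)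
    (hw : c • w.1 = w.1) {Gv : Type*} [Group Gv] (Kv : Subgroup Gv)
    (e e' : Gv ≃* ↥(unitaryGroupOfForm (galAdicCompletionMap (L := E) c hw) ((StdForm.antidiagonal 2).over (w.1.adicCompletion E))))
    (he : ∀ g, e g ∈ unitaryInt (galAdicCompletionMap (L := E) c hw) ((StdForm.antidiagonal 2).over (w.1.adicCompletion E)) ↔ g ∈ Kv)
    (he' : ∀ g, e' g ∈ unitaryInt (galAdicCompletionMap (L := E) c hw) ((StdForm.antidiagonal 2).over (w.1.adicCompletion E)) ↔ g ∈ Kv)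
    (T : heckeAlgebra k ↥(unitaryGroupOfForm (galAdicCompletionMap (L := E) c hw) ((StdForm.antidiagonal 2).over (w.1.adicCompletion E)))
      (unitaryInt (galAdicCompletionMap (L := E) c hw) ((StdForm.antidiagonal 2).over (w.1.adicCompletion E)))) :
    (fun g : Gv => (heckeAlgebra.toVector (unitaryInt (galAdicCompletionMap (L := E) c hw) ((StdForm.antidiagonal 2).over (w.1.adicCompletion E))) T).coeff
        ((e' g : ↥(unitaryGroupOfForm (galAdicCompletionMap (L := E) c hw) ((StdForm.antidiagonal 2).over (w.1.adicCompletion E)))) :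
          ↥(unitaryGroupOfForm (galAdicCompletionMap (L := E) c hw) ((StdForm.antidiagonal 2).over (w.1.adicCompletion E))) ⧸
            unitaryInt (galAdicCompletionMap (L := E) c hw) ((StdForm.antidiagonal 2).over (w.1.adicCompletion E)))) =
      fun g : Gv => (heckeAlgebra.toVector (unitaryInt (galAdicCompletionMap (L := E) c hw) ((StdForm.antidiagonal 2).over (w.1.adicCompletion E))) T).coeff
        ((e g : ↥(unitaryGroupOfForm (galAdicCompletionMap (L := E) c hw) ((StdForm.antidiagonal 2).over (w.1.adicCompletion E)))) :
          ↥(unitaryGroupOfForm (galAdicCompletionMap (L := E) c hw) ((StdForm.antidiagonal 2).over (w.1.adicCompletion E))) ⧸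
            unitaryInt (galAdicCompletionMap (L := E) c hw) ((StdForm.antidiagonal 2).over (w.1.adicCompletion E))) := by
  obtain ⟨ϖ, hd⟩ := UnitaryGroup.unramifiedLocalConjDatum_adicCompletion c hc v w hw hv
  exact coeff_toVector_comp_eq_of_memLaw Kv
    (unitaryInt (galAdicCompletionMap (L := E) c hw) ((StdForm.antidiagonal 2).over (w.1.adicCompletion E)))
    (fun u u' h => mem_orbit_of_ncard_orbit_eq_two_inert c v hc hv w hw hd u u' h) e e' he he' T

end InertPlace

end Summit.HodgeConjecture.HodgeConjecture.R90.S6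

end
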